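import Summits.Ventures.HodgeRepro2.T5BergmanSchurPolarized

/-!
# Godement's convolution identity for the matrix coefficients of `π_k`

The polarised Schur relations of `T5BergmanSchurPolarized` in convolution form: for holomorphic
`f, h, f', h' ∈ A_k` and `g ∈ SU(1,1)`,

  `∫_G ⟨π_k(g x⁻¹) f, h⟩_k · ⟨π_k(x) f', h'⟩_k dμ_R(x) = ⟨f, h'⟩_k · ⟨π_k(g) f', h⟩_k / (k - 1)`

(`integral_matrixCoeff_mul_inv_mul`): the convolution of two matrix coefficients is again a matrix
coefficient. The key is the identity `⟨π_k(g x⁻¹) f, h⟩_k = conj ⟨π_k(x) (π_k(g⁻¹) h), f⟩_k`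
(`matrixCoeff_mul_inv`: the representation property and unitarity), after which the integrand is the
one of the Schur relations with the pair `(π_k(g⁻¹) h, f)`. For a single vector `v` this is GODEMENT'S
IDEMPOTENT RELATION `φ_v * φ_v = (⟨v,v⟩_k/(k-1)) · φ_v` for `φ_v(g) = ⟨π_k(g) v, v⟩_k` (`godement`):
`d_v · φ_v` with `d_v = (k-1)/⟨v,v⟩_k` (the formal degree against `μ_R`, normalised by `‖v‖²`) is an
idempotent for convolution — for the lowest-weight vector, `(k-1)²/π · ⟨π_k(·) 1, 1⟩_k`
(`godement_lowest`). Nothing is claimed about (N).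

Blind lane: Mathlib + the HodgeRepro2 prefix only; no sorry; axioms ⊆ {propext, Classical.choice,
Quot.sound}.
-/

namespace Summit.Ventures.HodgeRepro2.T5BergmanGodement

open MeasureTheory MeasureTheory.Measure Metric Filter Topology Set
open T5PoincareDensity T5PoincareMeasure T5SU11Unimodular T5SU11Fibration T5SU11FibrationHaar
  T5SU11FibrationCartan T5HaarCircle T5SU11CoefficientL2
open T5BergmanCoefficient T5BergmanPairing T5BergmanUnitary T5BergmanCoefficientL2 T5BergmanFourier
  T5BergmanParseval T5BergmanProjection T5BergmanActStable T5BergmanMatrixCoeff T5BergmanSchur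
  T5BergmanSchurGeneral T5BergmanSchurPolarized
open scoped Real

/-! ### The pointwise identity -/

/-- `⟨π_k(g x⁻¹) f, h⟩_k = conj ⟨π_k(x) (π_k(g⁻¹) h), f⟩_k` for `k ≥ 2` (the representation property
`π_k(g x⁻¹) = π_k(g) π_k(x⁻¹)`, unitarity, and the conjugate symmetry of the pairing). -/
theorem matrixCoeff_mul_inv (k : ℕ) (hk : 2 ≤ k) (f h : ℂ → ℂ) (g x : SU11) :
    matrixCoeff k f h (g * x⁻¹) = (starRingEnd ℂ) (matrixCoeff k (act k g⁻¹ h) f x) := by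
  rw [matrixCoeff_mul]
  unfold matrixCoeff
  rw [pairing_act_left k hk g (act k x⁻¹ f) h, pairing_conj_symm k (act k g⁻¹ h) (act k x⁻¹ f),
    pairing_act_left k hk x (act k g⁻¹ h) f]

variable [MeasurableSpace Circle] [BorelSpace Circle]

/-! ### The convolution identity -/

/-- **The convolution of two matrix coefficients is a matrix coefficient** (`k ≥ 2`, holomorphic
`f, h, f', h' ∈ A_k`, against Rühl's measure `μ_R`):
`∫_G ⟨π_k(g x⁻¹) f, h⟩_k ⟨π_k(x) f', h'⟩_k dμ_R(x) = ⟨f, h'⟩_k ⟨π_k(g) f', h⟩_k / (k - 1)`. -/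
theorem integral_matrixCoeff_mul_inv_mul (k : ℕ) (hk : 2 ≤ k) (f h f' h' : ℂ → ℂ)
    (hf : DifferentiableOn ℂ f (ball 0 1))
    (hfint : IntegrableOn (fun w => ‖f w‖ ^ 2 * (1 - ‖w‖ ^ 2) ^ (k - 2)) (ball (0 : ℂ) 1))
    (hh : DifferentiableOn ℂ h (ball 0 1))
    (hhint : IntegrableOn (fun w => ‖h w‖ ^ 2 * (1 - ‖w‖ ^ 2) ^ (k - 2)) (ball (0 : ℂ) 1))
    (hf' : DifferentiableOn ℂ f' (ball 0 1))
    (hf'int : IntegrableOn (fun w => ‖f' w‖ ^ 2 * (1 - ‖w‖ ^ 2) ^ (k - 2)) (ball (0 : ℂ) 1))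
    (hh' : DifferentiableOn ℂ h' (ball 0 1))
    (hh'int : IntegrableOn (fun w => ‖h' w‖ ^ 2 * (1 - ‖w‖ ^ 2) ^ (k - 2)) (ball (0 : ℂ) 1))
    (g : SU11) :
    ∫ x, matrixCoeff k f h (g * x⁻¹) * matrixCoeff k f' h' x ∂ruhl =
      pairing k f h' * matrixCoeff k f' h g / ((k : ℂ) - 1) := by
  have hH : DifferentiableOn ℂ (act k g⁻¹ h) (ball 0 1) := differentiableOn_act k g⁻¹ h hh
  have hHint := integrableOn_act k hk g⁻¹ h hh hhint
  have e : ∀ x : SU11, matrixCoeff k f h (g * x⁻¹) * matrixCoeff k f' h' x =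
      (starRingEnd ℂ) (matrixCoeff k (act k g⁻¹ h) f x * (starRingEnd ℂ) (matrixCoeff k f' h' x)) := by
    intro x
    rw [matrixCoeff_mul_inv k hk f h g x, map_mul, Complex.conj_conj]
  simp_rw [e]
  rw [integral_conj, schur_relations k hk (act k g⁻¹ h) f' f h' hH hHint hf' hf'int hf hfint hh' hh'int,
    map_div₀, map_mul, ← pairing_conj_symm, ← pairing_conj_symm]
  have hk1 : (starRingEnd ℂ) ((k : ℂ) - 1) = (k : ℂ) - 1 := by
    rw [map_sub, map_one, Complex.conj_natCast]
  rw [hk1]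
  unfold matrixCoeff
  rw [pairing_act_left k hk g f' h]
  ring

/-- **Godement's idempotent relation** for `φ_v(g) = ⟨π_k(g) v, v⟩_k`:
`∫_G φ_v(g x⁻¹) φ_v(x) dμ_R(x) = (⟨v, v⟩_k / (k - 1)) · φ_v(g)`. -/
theorem godement (k : ℕ) (hk : 2 ≤ k) (v : ℂ → ℂ) (hv : DifferentiableOn ℂ v (ball 0 1))
    (hvint : IntegrableOn (fun w => ‖v w‖ ^ 2 * (1 - ‖w‖ ^ 2) ^ (k - 2)) (ball (0 : ℂ) 1))
    (g : SU11) :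
    ∫ x, matrixCoeff k v v (g * x⁻¹) * matrixCoeff k v v x ∂ruhl =
      pairing k v v / ((k : ℂ) - 1) * matrixCoeff k v v g := by
  rw [integral_matrixCoeff_mul_inv_mul k hk v v v v hv hvint hv hvint hv hvint hv hvint g]
  ring

/-- The normalised coefficient `d_v · φ_v`, `d_v = (k-1)/⟨v,v⟩_k`, is idempotent for convolution
(`⟨v,v⟩_k ≠ 0`). -/
theorem godement_normalized (k : ℕ) (hk : 2 ≤ k) (v : ℂ → ℂ) (hv : DifferentiableOn ℂ v (ball 0 1))
    (hvint : IntegrableOn (fun w => ‖v w‖ ^ 2 * (1 - ‖w‖ ^ 2) ^ (k - 2)) (ball (0 : ℂ) 1))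
    (hv0 : pairing k v v ≠ 0) (g : SU11) :
    ∫ x, (((k : ℂ) - 1) / pairing k v v * matrixCoeff k v v (g * x⁻¹)) *
        (((k : ℂ) - 1) / pairing k v v * matrixCoeff k v v x) ∂ruhl =
      ((k : ℂ) - 1) / pairing k v v * matrixCoeff k v v g := by
  have hk1 : ((k : ℂ) - 1) ≠ 0 := by
    have : (2 : ℝ) ≤ k := by exact_mod_cast hk
    have h2 : ((k : ℝ) - 1) ≠ 0 := by linarith
    exact_mod_cast h2
  have e : ∀ x : SU11, (((k : ℂ) - 1) / pairing k v v * matrixCoeff k v v (g * x⁻¹)) *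
      (((k : ℂ) - 1) / pairing k v v * matrixCoeff k v v x) =
      (((k : ℂ) - 1) / pairing k v v) ^ 2 * (matrixCoeff k v v (g * x⁻¹) * matrixCoeff k v v x) := by
    intro x
    ring
  simp_rw [e]
  rw [integral_const_mul, godement k hk v hv hvint g]
  field_simp

/-- Godement's relation for the lowest-weight vector (`⟨1,1⟩_k = π/(k-1)`):
`∫_G ⟨π_k(g x⁻¹) 1, 1⟩_k ⟨π_k(x) 1, 1⟩_k dμ_R(x) = (π/(k-1)²) ⟨π_k(g) 1, 1⟩_k`. -/
theorem godement_lowest (k : ℕ) (hk : 2 ≤ k) (g : SU11) :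
    ∫ x, matrixCoeff k lowest lowest (g * x⁻¹) * matrixCoeff k lowest lowest x ∂ruhl =
      ((π / ((k : ℝ) - 1) ^ 2 : ℝ) : ℂ) * matrixCoeff k lowest lowest g := by
  have hint : IntegrableOn (fun w => ‖lowest w‖ ^ 2 * (1 - ‖w‖ ^ 2) ^ (k - 2)) (ball (0 : ℂ) 1) := by
    refine (integrableOn_monomial k 0).congr_fun (fun w _ => ?_) measurableSet_ball
    simp [lowest]
  rw [godement k hk lowest (differentiableOn_const 1) hint g, pairing_lowest_lowest k hk]
  congr 1
  have hk1 : ((k : ℂ) - 1) ≠ 0 := by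
    have : (2 : ℝ) ≤ k := by exact_mod_cast hk
    have h2 : ((k : ℝ) - 1) ≠ 0 := by linarith
    exact_mod_cast h2
  push_cast
  field_simp

end Summit.Ventures.HodgeRepro2.T5BergmanGodement
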